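/-
Copyright (c) 2026 the pub-hodgecm-mathlib formalisation cell (harness21).  Prover seat hodgecm-mathlib-F0P2-p06 (g10): road «S3-tree» (LEAD F0P3a-plan (g11), architect
A-p16 (g29) ruling A-63 (1) «T2-E′ = THE LOCAL FIXED-SPHERE DICTIONARY»), brick T2-E′, FILE 1 = the dictionary at a HYPERSPECIAL (type-0) vertex; 2026-09-01.
-/
import Literature.NumberTheory.Automorphic.UnitaryLatticeTreeTypeTwoNormalForm   -- ★ T1d-C1 (B-p14 (g35)): `mem_mapGL_N₁_iff`, `firstColumn_props`, `scaleLattice_stdLattice_le_N₁_le`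
import HarnessLib

/-!
# The lattice graph of a hermitian space — T2-E′ FILE 1: THE FIXED STAR OF A HYPERSPECIAL VERTEX — an integral unitary `γ` fixes the type-two neighbour `κ·N₁` of the root
# `L₀ = 𝒪³` iff `γ̄` fixes the residual isotropic point `[κ̄ ē₀]` (Bruhat–Tits 1972 §10; Tits 1979 §3.3.3, §3.5; Serre, *Trees* II.1.1)

Topic `NumberTheory/Automorphic`; namespace `Literature.NumberTheory.Automorphic.UnitaryLatticeTree`.  THEOREMS ONLY (no definition, no instance, no notation, no named fact,
no `sorry`); kernel lane.  Cell `pub/hodgecm-mathlib` (D-0151), crux H413 = `stmt-HodgeConjecture-24833`; road «S3-tree» (census «S3» v3 0ca147ac), brick **T2-E′ «THE LOCAL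
FIXED-SPHERE DICTIONARY»** (architect A-p16 (g29) ruling A-63 (1), replacing the withdrawn «eigenframe shells» of census T2 75083796 §1–§2): for a `γ`-fixed vertex `x`,
`Fix(γ) ∩ S₁(x)` = the `γ̄_x`-fixed points of the residual geometry at `x`.  THIS FILE = the dictionary at the HYPERSPECIAL vertex `L₀ = 𝒪³` of the `U(3)` tree
(`H = J₀ = antidiag(1,1,1)`, pairing ★ `B₀ σ 3`, `K₀ = U(σ, J₀) ∩ GL₃(𝒪)` = ★ `unitaryInt`), in the currency of ★ T1a `UnitaryLatticeTreeDefs` (`latt`, `mapGL`, `stdLattice`,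
`latticeGraphIso`) and of ★ T1d-C1 `UnitaryLatticeTreeTypeTwoNormalForm` (the standard type-two neighbour `N₁ = latt diag(1, 1, ϖ)` and `mem_mapGL_N₁_iff`: for `κ ∈ K₀` and
`y ∈ 𝒪³`, `y ∈ κ·N₁ ↔ |B₀ (κe₀) y| ≤ |ϖ|` — the neighbour `κ·N₁` is the residual hyperplane `N_x = {y ∈ 𝒪³ | B₀ x y ∈ 𝔪}` of its ISOTROPIC PRIMITIVE vector `x = κe₀`).
Every other hyperspecial vertex is `u·L₀` and its star is `u·(star of L₀)` (★ transitivity of `U(σ, J₀)` on self-dual lattices), so the dictionary at `L₀` is the general one.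
HONEST LABEL: HC_CM is proved only modulo the 2 remaining named inputs (hLiu418 24832, h413 24833) until rung 0 closes; nothing printed is asserted here (elementary lattice
algebra over a valuation ring); S3 (`stub_N6nsS3id`) stays a print row until the road's END lands.

THE MATHEMATICS.  `K` a field with `Valued K ℤᵐ⁰`, `σ` a ring endomorphism preserving `v` (no involution or unramifiedness hypothesis is needed in §1–§2), `x, x′ ∈ 𝒪^N`
PRIMITIVE (some coordinate a unit).  The residual form `B̄₀` on `𝓀^N` is non-degenerate, so the residual hyperplanes `x̄^⊥ ⊇ x̄′^⊥`... coincide iff `x̄′ ∈ 𝓀^× x̄`; in valuation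
language (§1, no residue field needed): **`(∀ y ∈ 𝒪^N, B₀ x y ∈ 𝔪 → B₀ x′ y ∈ 𝔪) ↔ ∃ c, |c| = 1 ∧ ∀ i, |x′_i − c·x_i| < 1`** — (⇐) `B₀ (c x) y = σ(c)·B₀ x y` and the
congruence ★ `v_B₀_lt_one_iff_of_congr`; (⇒) test the hypothesis on the integral vectors `y⁽ⁱ⁾ = σ(x_j)·e_{rev i} − σ(x_i)·e_{rev j}` (`j` a unit coordinate of `x`), for which
`B₀ x y⁽ⁱ⁾ = 0` and `B₀ x′ y⁽ⁱ⁾ = σ(x′_i x_j − x′_j x_i)`, and put `c = x′_j ∕ x_j` (a unit because `x′` is primitive).  §2 dresses this as the FIXED-STAR TEST at `L₀` for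
`N = 3`: for `γ, κ ∈ K₀`, `γ·(κ·N₁) = (γκ)·N₁ = N_{γκe₀}`, so **`γ·(κ·N₁) = κ·N₁ ↔ ∃ c, |c| = 1 ∧ ∀ i, |(γκe₀)_i − c·(κe₀)_i| < 1`** («`γ` fixes the type-two neighbour of `L₀`
through the isotropic point `[x̄]`, `x = κe₀`, iff `γ̄ x̄ ∈ 𝓀^× x̄`»), with its vertex form for ★ `latticeGraphIso`; §3: a residually scalar `γ ∈ K₀` (in particular `γ ∈ K₀(1)`,
`|γ − 1| < 1` entrywise) fixes every `κ·N₁` — the whole star of `L₀` (the first layer of «deep `γ` fix large balls»).  The COUNTS of `γ̄`-fixed isotropic points by the residual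
Jordan ∕ eigen type of `γ̄` (scalar `q³+1` = ★ `HermitianCurvePointCount`; non-identity unipotent: exactly one, ★ `exists_isotropic_fixed_of_isNilpotent` (F0P3a-p08 (g17)) +
`UnitaryThreeUnipotentFixedIsotropicUnique` (F0P3-p03 (g13) ∕ F0P3-p01 (g16)); repeated norm-one eigenvalue on a non-degenerate eigenplane `q+1`; regular norm-one eigenvalues `0`)
are the finite-geometry organs of T3′, consumed through this dictionary; the bijection «type-two neighbours of `L₀`» ↔ «isotropic points of `(𝓀³, B̄₀)`» (surjectivity `M = κ·N₁`:
★ root-star transitivity `exists_mem_unitaryInt_rootStar_eq` ∕ T1d′; injectivity: `mapGL_N₁_eq_mapGL_N₁_iff` below) is T1's valency lemma (B-p14 (g35)).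

* §1 `B₀_smul_left_v` (`|B₀ (c•x) y| = |c|·|B₀ x y|`), `exists_unit_congr_of_forall_v_B₀_lt_one` (⇒), `forall_v_B₀_lt_one_iff_of_exists_unit_congr` (⇐, as an `iff` of
  hyperplanes), **`forall_v_B₀_lt_one_imp_iff_exists_unit_congr`** (the residual-hyperplane dictionary, any `N`).
* §2 (`N = 3`, `J₀`, `N₁ = latt diag(1,1,ϖ)`): **`mapGL_N₁_eq_mapGL_N₁_iff`** (`κ′·N₁ = κ·N₁ ↔ κ′e₀ ≡ c·κe₀`), **`mapGL_mul_N₁_eq_iff`** (THE FIXED-STAR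
  TEST), `latticeGraphIso_N₁_eq_iff` (vertex form).
* §3 `mapGL_mul_N₁_eq_of_residually_scalar`, `mapGL_mul_N₁_eq_of_congr_one` (`K₀(1)` fixes the star of `L₀`).

## References
* [BruhatTits1972] F. Bruhat, J. Tits, *Groupes réductifs sur un corps local I*, Publ. Math. IHÉS 41 (1972), §10 (lattice models; the star of a vertex = the residual building).
* [Tits1979] J. Tits, *Reductive groups over local fields*, PSPM 33.1 (1979), §3.3.3 (hyperspecial `K₀`), §3.5 (reduction mod `𝔭`: `K₀ ∕ K₀(1)` acts on the star through `Ḡ(𝓀)`).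
* [Serre1980Trees] J.-P. Serre, *Trees* (1980), Ch. II §1.1 (neighbours of a lattice = lines of its reduction).
-/

set_option autoImplicit false

noncomputable section

open scoped Valued WithZero Matrix MatrixGroups

namespace Literature.NumberTheory.Automorphic.UnitaryLatticeTree

open Literature.NumberTheory.Automorphic Literature.NumberTheory.Automorphic.HermitianLattice

variable {K : Type*} [Field K] [Valued K ℤᵐ⁰] {σ : K →+* K} {ϖ : K} {N : ℕ}

/-! ## §1 The residual-hyperplane dictionary (any `N`): `x̄′^⊥ ⊇ x̄^⊥ ↔ x̄′ ∈ 𝓀^× x̄`, in valuation language -/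

omit [Valued K ℤᵐ⁰] in
/-- `B₀ (c • x) y = σ c · B₀ x y`. [cite: Serre1980Trees, II.1.1] -/
theorem B₀_smul_left (c : K) (x y : Fin N → K) : B₀ σ N (c • x) y = σ c * B₀ σ N x y := by
  rw [LinearMap.map_smulₛₗ, LinearMap.smul_apply, smul_eq_mul]

/-- **(⇐) Residually proportional primitive vectors cut out the same residual hyperplane**: if `x′ ≡ c·x (mod 𝔪)` coordinatewise with `|c| = 1`, then for every `y ∈ 𝒪^N`,
`B₀ x′ y ∈ 𝔪 ↔ B₀ x y ∈ 𝔪`. [cite: Serre1980Trees, II.1.1] [cite: Tits1979, §3.5] -/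
theorem forall_v_B₀_lt_one_iff_of_exists_unit_congr (hvσ : ∀ a, Valued.v (σ a) = Valued.v a) {x x' : Fin N → K}
    (h : ∃ c : K, Valued.v c = 1 ∧ ∀ i, Valued.v (x' i - c * x i) < 1) :
    ∀ y ∈ stdLattice K N, (Valued.v (B₀ σ N x' y) < 1 ↔ Valued.v (B₀ σ N x y) < 1) := by
  obtain ⟨c, hc, hcong⟩ := h
  intro y hy
  have hr : WithZero.exp (-1 : ℤ) < (1 : ℤᵐ⁰) := by
    rw [← WithZero.exp_zero]; exact WithZero.exp_lt_exp.2 (by norm_num)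
  have hxx' : ∀ i, Valued.v (x' i - (c • x) i) ≤ WithZero.exp (-1 : ℤ) := fun i => by
    rw [Pi.smul_apply, smul_eq_mul]; exact (v_lt_one_iff _).1 (hcong i)
  rw [← v_B₀_lt_one_iff_of_congr hvσ hr hxx' hy, B₀_smul_left, map_mul, hvσ, hc, one_mul]

/-- **(⇒) If the residual hyperplane of `x` is contained in that of `x′` then `x̄′ ∈ 𝓀^× x̄`**: for `x, x′ ∈ 𝒪^N` primitive, `(∀ y ∈ 𝒪^N, B₀ x y ∈ 𝔪 → B₀ x′ y ∈ 𝔪)` forces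
`x′ ≡ c·x (mod 𝔪)` for a unit `c` (test on `y⁽ⁱ⁾ = σ(x_j) e_{rev i} − σ(x_i) e_{rev j}`, `j` a unit coordinate of `x`; `c = x′_j ∕ x_j`). [cite: Serre1980Trees, II.1.1] [cite: Tits1979, §3.5] -/
theorem exists_unit_congr_of_forall_v_B₀_lt_one (hvσ : ∀ a, Valued.v (σ a) = Valued.v a) {x x' : Fin N → K}
    (hx : x ∈ stdLattice K N) (hxu : ∃ j, Valued.v (x j) = 1) (hx' : x' ∈ stdLattice K N) (hx'u : ∃ j, Valued.v (x' j) = 1)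
    (h : ∀ y ∈ stdLattice K N, Valued.v (B₀ σ N x y) < 1 → Valued.v (B₀ σ N x' y) < 1) :
    ∃ c : K, Valued.v c = 1 ∧ ∀ i, Valued.v (x' i - c * x i) < 1 := by
  obtain ⟨j, hj⟩ := hxu
  have hxj0 : x j ≠ 0 := fun h0 => by rw [h0, map_zero] at hj; exact zero_ne_one hj
  -- the key estimate `|x′_i x_j − x′_j x_i| < 1`, from the test vector `y⁽ⁱ⁾ = σ(x_j) e_{rev i} − σ(x_i) e_{rev j}`
  have key : ∀ i, Valued.v (x' i * x j - x' j * x i) < 1 := by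
    intro i
    by_cases hij : i = j
    · subst hij; rw [mul_comm, sub_self, map_zero]; exact zero_lt_one
    have hB : ∀ z : Fin N → K, B₀ σ N z (Pi.single (Fin.rev i) (σ (x j)) - Pi.single (Fin.rev j) (σ (x i))) = σ (z i * x j - z j * x i) := by
      intro z
      rw [map_sub, show (Pi.single (Fin.rev i) (σ (x j)) : Fin N → K) = σ (x j) • Pi.single (Fin.rev i) 1 by
            rw [← Pi.single_smul', smul_eq_mul, mul_one],
        show (Pi.single (Fin.rev j) (σ (x i)) : Fin N → K) = σ (x i) • Pi.single (Fin.rev j) 1 by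
            rw [← Pi.single_smul', smul_eq_mul, mul_one],
        map_smul, map_smul, B₀_single_right, B₀_single_right, Fin.rev_rev, Fin.rev_rev, smul_eq_mul, smul_eq_mul, map_sub, map_mul, map_mul]
      ring
    have hy : (Pi.single (Fin.rev i) (σ (x j)) - Pi.single (Fin.rev j) (σ (x i)) : Fin N → K) ∈ stdLattice K N := by
      refine Submodule.sub_mem _ (fun k => ?_) (fun k => ?_)
      · by_cases hk : k = Fin.rev i
        · subst hk; rw [Pi.single_eq_same, hvσ]; exact hx j
        · rw [Pi.single_eq_of_ne hk, map_zero]; exact zero_le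
      · by_cases hk : k = Fin.rev j
        · subst hk; rw [Pi.single_eq_same, hvσ]; exact hx i
        · rw [Pi.single_eq_of_ne hk, map_zero]; exact zero_le
    have h0 : Valued.v (B₀ σ N x (Pi.single (Fin.rev i) (σ (x j)) - Pi.single (Fin.rev j) (σ (x i)))) < 1 := by
      rw [hB, mul_comm (x i) (x j), sub_self, map_zero, map_zero]; exact zero_lt_one
    have h1 := h _ hy h0
    rwa [hB, hvσ] at h1
  -- `c = x′_j / x_j` is a unit: otherwise every coordinate of `x′` would be small
  have hcle : Valued.v (x' j / x j) ≤ 1 := by rw [map_div₀, hj, div_one]; exact hx' j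
  have hc : Valued.v (x' j / x j) = 1 := by
    refine le_antisymm hcle (not_lt.1 fun hlt => ?_)
    rw [map_div₀, hj, div_one] at hlt
    obtain ⟨j', hj'⟩ := hx'u
    have hbig : Valued.v (x' j' * x j) = 1 := by rw [map_mul, hj', hj, one_mul]
    have hsmall : Valued.v (x' j * x j') < Valued.v (x' j' * x j) := by
      rw [hbig, map_mul]
      calc Valued.v (x' j) * Valued.v (x j') ≤ Valued.v (x' j) * 1 := mul_le_mul_right (hx j') _
        _ < 1 := by rw [mul_one]; exact hlt
    have := key j'
    rw [Valuation.map_sub_eq_of_lt_left _ hsmall, hbig] at this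
    exact lt_irrefl _ this
  refine ⟨x' j / x j, hc, fun i => ?_⟩
  have : x' i - x' j / x j * x i = (x' i * x j - x' j * x i) / x j := by field_simp
  rw [this, map_div₀, hj, div_one]
  exact key i

/-- **THE RESIDUAL-HYPERPLANE DICTIONARY** (any `N`): for primitive `x, x′ ∈ 𝒪^N`, `x̄^⊥ ⊆ x̄′^⊥` (as sets of `y ∈ 𝒪^N` with `B₀ · y ∈ 𝔪`) iff `x′ ≡ c·x (mod 𝔪)` for a unit `c` —
the non-degeneracy of the residual form `B̄₀`, without residue fields. [cite: Serre1980Trees, II.1.1] [cite: Tits1979, §3.5] -/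
theorem forall_v_B₀_lt_one_imp_iff_exists_unit_congr (hvσ : ∀ a, Valued.v (σ a) = Valued.v a) {x x' : Fin N → K}
    (hx : x ∈ stdLattice K N) (hxu : ∃ j, Valued.v (x j) = 1) (hx' : x' ∈ stdLattice K N) (hx'u : ∃ j, Valued.v (x' j) = 1) :
    (∀ y ∈ stdLattice K N, Valued.v (B₀ σ N x y) < 1 → Valued.v (B₀ σ N x' y) < 1) ↔ ∃ c : K, Valued.v c = 1 ∧ ∀ i, Valued.v (x' i - c * x i) < 1 :=
  ⟨exists_unit_congr_of_forall_v_B₀_lt_one hvσ hx hxu hx' hx'u, fun h y hy hxy => (forall_v_B₀_lt_one_iff_of_exists_unit_congr hvσ h y hy).2 hxy⟩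

/-! ## §2 The fixed-star test at the hyperspecial vertex `L₀ = 𝒪³` of the `U(3)` tree -/

section Star

variable {σ : K →+* K} {ϖ : K}

/-- **SAME NEIGHBOUR ↔ SAME RESIDUAL POINT**: for `κ, κ′ ∈ K₀`, `κ′·N₁ = κ·N₁ ↔ κ′e₀ ≡ c·κe₀ (mod 𝔪)` for a unit `c` — the type-two neighbour `κ·N₁` of `L₀` is the residual
isotropic point `[κ̄ ē₀] ∈ ℙ(𝓀³)` (injectivity half of «star of `L₀` = isotropic points of `(𝓀³, B̄₀)`»).  TOKEN NOTE for consumers: the first column is spelled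
`(↑↑κ : Matrix …) i 0` here and `(↑↑κ).mulVec (Pi.single 0 1) i` in ★ T1d-C1∕C2 (`firstColumn_props`, `mem_mapGL_N₁_iff`); the two meet by `Matrix.mulVec_single_one` (one `rw`,
as in the proof).  The `κ′ = 1` instance is ★ `UnitaryLatticeTreeTypeTwoParent.mapGL_N₁_eq_of_v_lt_one` (isotropy + primitivity turn `|x₂| < 1` into `x ≡ c·e₀`).
[cite: BruhatTits1972, §10] [cite: Tits1979, §3.5] -/
theorem mapGL_N₁_eq_mapGL_N₁_iff (hvσ : ∀ a, Valued.v (σ a) = Valued.v a) (hϖ : Valued.v ϖ = WithZero.exp (-1 : ℤ))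
    {κ κ' : unitaryGroupOfForm σ ((StdForm.antidiagonal 3).over K)}
    (hκ : κ ∈ unitaryInt σ ((StdForm.antidiagonal 3).over K)) (hκ' : κ' ∈ unitaryInt σ ((StdForm.antidiagonal 3).over K)) :
    mapGL (κ' : GL (Fin 3) K) (latt (Matrix.diagonal ![(1 : K), 1, ϖ])) = mapGL (κ : GL (Fin 3) K) (latt (Matrix.diagonal ![(1 : K), 1, ϖ])) ↔
      ∃ c : K, Valued.v c = 1 ∧ ∀ i, Valued.v (((κ' : GL (Fin 3) K) : Matrix (Fin 3) (Fin 3) K) i 0 - c * ((κ : GL (Fin 3) K) : Matrix (Fin 3) (Fin 3) K) i 0) < 1 := by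
  have hϖ0 : ϖ ≠ 0 := fun h0 => by rw [h0, map_zero] at hϖ; exact WithZero.coe_ne_zero hϖ.symm
  have hϖ1 : Valued.v ϖ ≤ 1 := by rw [hϖ, ← WithZero.exp_zero]; exact WithZero.exp_le_exp.2 (by norm_num)
  have hlt : ∀ z : K, Valued.v z < 1 ↔ Valued.v z ≤ Valued.v ϖ := fun z => by rw [hϖ]; exact v_lt_one_iff z
  -- `K₀`-translates of `N₁` lie in the root `𝒪³` (= (★ `UnitaryLatticeTreeTypeTwoParent.mapGL_N₁_le`).2, re-derived to keep the import cone at T1d-C1)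
  have hle : ∀ {g : unitaryGroupOfForm σ ((StdForm.antidiagonal 3).over K)}, g ∈ unitaryInt σ ((StdForm.antidiagonal 3).over K) →
      mapGL (g : GL (Fin 3) K) (latt (Matrix.diagonal ![(1 : K), 1, ϖ])) ≤ stdLattice K 3 := fun {g} hg =>
    calc mapGL (g : GL (Fin 3) K) (latt (Matrix.diagonal ![(1 : K), 1, ϖ])) ≤ mapGL (g : GL (Fin 3) K) (stdLattice K 3) :=
          (mapGL_le_mapGL_iff _ _ _).2 (scaleLattice_stdLattice_le_N₁_le hϖ1 hϖ0).2
      _ = stdLattice K 3 := mapGL_stdLattice_of_mem_unitaryInt hg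
  -- the first columns `x = κe₀`, `x′ = κ′e₀`: integral, primitive
  obtain ⟨hx, -, hxu⟩ := firstColumn_props hκ
  obtain ⟨hx', -, hx'u⟩ := firstColumn_props hκ'
  have hcol : ∀ (g : unitaryGroupOfForm σ ((StdForm.antidiagonal 3).over K)) (i : Fin 3),
      ((g : GL (Fin 3) K) : Matrix (Fin 3) (Fin 3) K).mulVec (Pi.single 0 1) i = ((g : GL (Fin 3) K) : Matrix (Fin 3) (Fin 3) K) i 0 := fun g i => by
    rw [Matrix.mulVec_single_one]; rfl
  constructor
  · -- (⇒): `κ′N₁ = κN₁` ⇒ the residual hyperplane of `x` lies in that of `x′` ⇒ `x′ ≡ c x`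
    intro heq
    obtain ⟨c, hc, hcong⟩ := exists_unit_congr_of_forall_v_B₀_lt_one hvσ hx hxu hx' hx'u fun y hy hxy => by
      have hmem : y ∈ mapGL (κ : GL (Fin 3) K) (latt (Matrix.diagonal ![(1 : K), 1, ϖ])) := (mem_mapGL_N₁_iff hκ hϖ0 hy).2 ((hlt _).1 hxy)
      rw [← heq] at hmem
      exact (hlt _).2 ((mem_mapGL_N₁_iff hκ' hϖ0 hy).1 hmem)
    exact ⟨c, hc, fun i => by rw [← hcol κ' i, ← hcol κ i]; exact hcong i⟩
  · -- (⇐): congruent isotropic vectors cut out the same neighbour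
    rintro ⟨c, hc, hcong⟩
    have hiff := forall_v_B₀_lt_one_iff_of_exists_unit_congr hvσ (x := ((κ : GL (Fin 3) K) : Matrix (Fin 3) (Fin 3) K).mulVec (Pi.single 0 1))
      (x' := ((κ' : GL (Fin 3) K) : Matrix (Fin 3) (Fin 3) K).mulVec (Pi.single 0 1)) ⟨c, hc, fun i => by rw [hcol κ' i, hcol κ i]; exact hcong i⟩
    apply le_antisymm
    · intro y hy
      have hy𝒪 : y ∈ stdLattice K 3 := hle hκ' hy
      exact (mem_mapGL_N₁_iff hκ hϖ0 hy𝒪).2 ((hlt _).1 (((hiff y hy𝒪).1 ((hlt _).2 ((mem_mapGL_N₁_iff hκ' hϖ0 hy𝒪).1 hy)))))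
    · intro y hy
      have hy𝒪 : y ∈ stdLattice K 3 := hle hκ hy
      exact (mem_mapGL_N₁_iff hκ' hϖ0 hy𝒪).2 ((hlt _).1 (((hiff y hy𝒪).2 ((hlt _).2 ((mem_mapGL_N₁_iff hκ hϖ0 hy𝒪).1 hy)))))

/-- **THE FIXED-STAR TEST AT `L₀`** (T2-E′, type 0): for `γ, κ ∈ K₀`, the integral unitary `γ` FIXES the type-two neighbour `κ·N₁` of the root iff `γ̄` fixes the residual isotropic
point `[κ̄ ē₀]`: `γ·(κ·N₁) = κ·N₁ ↔ ∃ c, |c| = 1 ∧ ∀ i, |(γκ)_{i0} − c·κ_{i0}| < 1`.  Hence `Fix(γ) ∩ S₁(L₀)` ↔ the `γ̄`-fixed points of the Hermitian curve of `(𝓀³, B̄₀)`,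
counted by the residual Jordan ∕ eigen type of `γ̄` (organs of T3′). [cite: BruhatTits1972, §10] [cite: Tits1979, §3.5] [cite: Serre1980Trees, II.1.1] -/
theorem mapGL_mul_N₁_eq_iff (hvσ : ∀ a, Valued.v (σ a) = Valued.v a) (hϖ : Valued.v ϖ = WithZero.exp (-1 : ℤ))
    {γ κ : unitaryGroupOfForm σ ((StdForm.antidiagonal 3).over K)}
    (hγ : γ ∈ unitaryInt σ ((StdForm.antidiagonal 3).over K)) (hκ : κ ∈ unitaryInt σ ((StdForm.antidiagonal 3).over K)) :
    mapGL (γ : GL (Fin 3) K) (mapGL (κ : GL (Fin 3) K) (latt (Matrix.diagonal ![(1 : K), 1, ϖ]))) =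
        mapGL (κ : GL (Fin 3) K) (latt (Matrix.diagonal ![(1 : K), 1, ϖ])) ↔
      ∃ c : K, Valued.v c = 1 ∧
        ∀ i, Valued.v ((((γ : GL (Fin 3) K) : Matrix (Fin 3) (Fin 3) K) * ((κ : GL (Fin 3) K) : Matrix (Fin 3) (Fin 3) K)) i 0 - c * ((κ : GL (Fin 3) K) : Matrix (Fin 3) (Fin 3) K) i 0) < 1 := by
  have h := mapGL_N₁_eq_mapGL_N₁_iff hvσ hϖ hκ (Subgroup.mul_mem _ hγ hκ)
  rw [Subgroup.coe_mul, Units.val_mul] at h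
  rw [← mapGL_mul]
  exact h

/-- **Vertex form of the fixed-star test**: for the vertex `v` of ★ `latticeGraph σ ϖ J₀` with `v.1 = κ·N₁` and `γ ∈ K₀`, `latticeGraphIso σ ϖ J₀ γ v = v` iff `γ̄` fixes
`[κ̄ ē₀]`. [cite: BruhatTits1972, §10] [cite: Tits1979, §3.5] -/
theorem latticeGraphIso_N₁_eq_iff (hvσ : ∀ a, Valued.v (σ a) = Valued.v a) (hϖ : Valued.v ϖ = WithZero.exp (-1 : ℤ))
    {γ κ : unitaryGroupOfForm σ ((StdForm.antidiagonal 3).over K)}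
    (hγ : γ ∈ unitaryInt σ ((StdForm.antidiagonal 3).over K)) (hκ : κ ∈ unitaryInt σ ((StdForm.antidiagonal 3).over K))
    (v : {M : Submodule 𝒪[K] (Fin 3 → K) // IsVertex σ ϖ ((StdForm.antidiagonal 3).over K) M})
    (hv : v.1 = mapGL (κ : GL (Fin 3) K) (latt (Matrix.diagonal ![(1 : K), 1, ϖ]))) :
    latticeGraphIso σ ϖ ((StdForm.antidiagonal 3).over K) γ v = v ↔
      ∃ c : K, Valued.v c = 1 ∧
        ∀ i, Valued.v ((((γ : GL (Fin 3) K) : Matrix (Fin 3) (Fin 3) K) * ((κ : GL (Fin 3) K) : Matrix (Fin 3) (Fin 3) K)) i 0 - c * ((κ : GL (Fin 3) K) : Matrix (Fin 3) (Fin 3) K) i 0) < 1 := by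
  rw [← mapGL_mul_N₁_eq_iff hvσ hϖ hγ hκ, ← hv, Subtype.ext_iff, latticeGraphIso_apply_coe]
  rfl

/-! ## §3 A residually scalar `γ` fixes the whole star of `L₀` -/

/-- If `γ ∈ K₀` is RESIDUALLY SCALAR (`γ ≡ c·1 (mod 𝔪)` entrywise, `|c| = 1`) then `γ` fixes every type-two neighbour `κ·N₁` of `L₀`. [cite: Tits1979, §3.5] [cite: BruhatTits1972, §10] -/
theorem mapGL_mul_N₁_eq_of_residually_scalar (hvσ : ∀ a, Valued.v (σ a) = Valued.v a) (hϖ : Valued.v ϖ = WithZero.exp (-1 : ℤ))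
    {γ κ : unitaryGroupOfForm σ ((StdForm.antidiagonal 3).over K)}
    (hγ : γ ∈ unitaryInt σ ((StdForm.antidiagonal 3).over K)) (hκ : κ ∈ unitaryInt σ ((StdForm.antidiagonal 3).over K))
    {c : K} (hc : Valued.v c = 1) (hγc : ∀ i j, Valued.v (((γ : GL (Fin 3) K) : Matrix (Fin 3) (Fin 3) K) i j - c * (1 : Matrix (Fin 3) (Fin 3) K) i j) < 1) :
    mapGL (γ : GL (Fin 3) K) (mapGL (κ : GL (Fin 3) K) (latt (Matrix.diagonal ![(1 : K), 1, ϖ]))) =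
      mapGL (κ : GL (Fin 3) K) (latt (Matrix.diagonal ![(1 : K), 1, ϖ])) := by
  refine (mapGL_mul_N₁_eq_iff hvσ hϖ hγ hκ).2 ⟨c, hc, fun i => ?_⟩
  have hκ1 := (mem_unitaryInt_iff.1 hκ).1
  -- `(γκ)_{i0} − c κ_{i0} = Σ_j (γ_{ij} − c δ_{ij}) κ_{j0}`
  have hentry : (((γ : GL (Fin 3) K) : Matrix (Fin 3) (Fin 3) K) * ((κ : GL (Fin 3) K) : Matrix (Fin 3) (Fin 3) K)) i 0 -
      c * ((κ : GL (Fin 3) K) : Matrix (Fin 3) (Fin 3) K) i 0 =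
      ∑ j, (((γ : GL (Fin 3) K) : Matrix (Fin 3) (Fin 3) K) i j - c * (1 : Matrix (Fin 3) (Fin 3) K) i j) * ((κ : GL (Fin 3) K) : Matrix (Fin 3) (Fin 3) K) j 0 := by
    have h1 : (((γ : GL (Fin 3) K) : Matrix (Fin 3) (Fin 3) K) - c • (1 : Matrix (Fin 3) (Fin 3) K)) * ((κ : GL (Fin 3) K) : Matrix (Fin 3) (Fin 3) K) =
        ((γ : GL (Fin 3) K) : Matrix (Fin 3) (Fin 3) K) * ((κ : GL (Fin 3) K) : Matrix (Fin 3) (Fin 3) K) - c • ((κ : GL (Fin 3) K) : Matrix (Fin 3) (Fin 3) K) := by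
      rw [sub_mul, Matrix.smul_mul, Matrix.one_mul]
    have h2 := congr_fun (congr_fun h1 i) 0
    rw [Matrix.sub_apply, Matrix.smul_apply, smul_eq_mul] at h2
    rw [← h2, Matrix.mul_apply]
    refine Finset.sum_congr rfl fun j _ => ?_
    rw [Matrix.sub_apply, Matrix.smul_apply, smul_eq_mul]
  rw [hentry]
  refine Valuation.map_sum_lt _ one_ne_zero fun j _ => ?_
  rw [map_mul]
  calc Valued.v (((γ : GL (Fin 3) K) : Matrix (Fin 3) (Fin 3) K) i j - c * (1 : Matrix (Fin 3) (Fin 3) K) i j) * Valued.v (((κ : GL (Fin 3) K) : Matrix (Fin 3) (Fin 3) K) j 0)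
        ≤ Valued.v (((γ : GL (Fin 3) K) : Matrix (Fin 3) (Fin 3) K) i j - c * (1 : Matrix (Fin 3) (Fin 3) K) i j) * 1 := mul_le_mul_right (hκ1 j 0) _
    _ < 1 := by rw [mul_one]; exact hγc i j

/-- **`K₀(1)` FIXES THE STAR OF `L₀`**: if `γ ∈ K₀` has `|γ_{ij} − δ_{ij}| < 1` for all `i, j` then `γ·(κ·N₁) = κ·N₁` for every `κ ∈ K₀` (the first layer of «a deep `γ` fixes a
large ball»; iterated along ★ T4′(b) `UnitaryLatticeTreeLevelShift`). [cite: Tits1979, §3.5] [cite: BruhatTits1972, §10] -/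
theorem mapGL_mul_N₁_eq_of_congr_one (hvσ : ∀ a, Valued.v (σ a) = Valued.v a) (hϖ : Valued.v ϖ = WithZero.exp (-1 : ℤ))
    {γ κ : unitaryGroupOfForm σ ((StdForm.antidiagonal 3).over K)}
    (hγ : γ ∈ unitaryInt σ ((StdForm.antidiagonal 3).over K)) (hκ : κ ∈ unitaryInt σ ((StdForm.antidiagonal 3).over K))
    (hγ1 : ∀ i j, Valued.v ((((γ : GL (Fin 3) K) : Matrix (Fin 3) (Fin 3) K) - 1) i j) < 1) :
    mapGL (γ : GL (Fin 3) K) (mapGL (κ : GL (Fin 3) K) (latt (Matrix.diagonal ![(1 : K), 1, ϖ]))) =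
      mapGL (κ : GL (Fin 3) K) (latt (Matrix.diagonal ![(1 : K), 1, ϖ])) :=
  mapGL_mul_N₁_eq_of_residually_scalar hvσ hϖ hγ hκ (c := 1) (map_one _) fun i j => by rw [one_mul, ← Matrix.sub_apply]; exact hγ1 i j

end Star

end Literature.NumberTheory.Automorphic.UnitaryLatticeTree

end
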